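import Summits.BirchSwinnertonDyer.BirchSwinnertonDyer.Theorems.SchneiderFreeAdditiveX3GordCellThreeAux
import Summits.BirchSwinnertonDyer.Rank1Residual.AdditivePotMult.PStarTwistModel
import Literature.NumberTheory.EllipticCurves.TateCurve.NumberFieldUniformization
import Literature.NumberTheory.EllipticCurves.TateCurve.NumberFieldUniformizationTwisted
import HarnessLib

/-!
# Route `SchneiderFreeAdditiveX3` (K1 door), local theory at `p = 3` on BOTH semistable-twist cells: one member of the Teichmüller pair of every
# rational `3`-line of `W = C • V^{(−3)}` is UNRAMIFIED at `3` — `V` MULTIPLICATIVE at `3` (the (M) cell) as well as `V` good ordinary (the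
# (G-ord, `e = 2`) cell, `…GordCellThreeAux`); the cell-level statement on `ClassX3 W 3 ∧ SubSemistableTwist W 3`

Cell `bsd-schneider-ideate`, seat `bsd-schneider-door-c5` (prover, generation 27; assembly layer; `--supports` 19177, FYI 19176).
PARTITION: board row B6 ∩ X3 ∩ sst-twist, `r = 1`, BOTH halves at `p = 3` ((G-ord, `e = 2`) 2 411 + (M) 4 383 pairs) of `Rank1Residual.partition` —
local Galois bookkeeping; types-the-object-of nothing; closes none of B6's cells (BSD NOT advanced).  bears_on: K1-door (19177 r3; FYI 19176 r2).

WHAT.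
* §1 `isUnramifiedAt_of_forall_mem_inertia_of_mem_primesAbove` — for a framed representation `ρ : Γ_K → GL_n(A)` and a place `v`, killing ONE
  inertia group `I_𝔓`, `𝔓 ∣ v`, suffices (`I_{τ𝔓} = τ I_𝔓 τ⁻¹`, `exists_smul_eq_of_mem_primesAbove_holds`, `Ideal.conj_mem_inertia_smul_iff`) — the
  any-prime form of `TeichmullerPairUnramifiedAtMult.isUnramifiedAt_of_forall_mem_inertia_chosen`.
* §2 **`teichmullerPair_isUnramifiedAt_or_of_mult_negThree_twist`** — `V` globally minimal MULTIPLICATIVE at `3` (split or not), `W = C • V^{(−3)}`,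
  `Φ ≤ W[3]` a rational line, `(θsub, θquot)` its Teichmüller pair: ONE member is UNRAMIFIED at `3`.  The `I_𝔓`-fixed line is the tree's TB-TOL
  on the (M) rows (`MixedCongruence.exists_twistedOrdinaryLineAt_three_of_mult_twist_model`, X2's Tate line + Kummer; its Tate-uniformisation
  inputs are the tree's PROVED `Silverman1994_thmV53_tateUniformisation_holds` / `…_corV54_…_holds`), then `KYBranchThreeAux.fix_or_quot_of_fixedLine`
  and Teichmüller rigidity.  ("`W[3]|_{I_3} ≅ 𝟙 ⊕ ω`" on the (M) cell too: the Tate line carries `ω`, twisted by `χ₋₃|_{I_3} = ω` it becomes `𝟙`.)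
* §3 **`teichmullerPair_isUnramifiedAt_or_of_classX3_of_subSemistableTwist_three`** — the CELL-LEVEL statement: for every globally minimal `W`
  with `ClassX3 W 3` and `SubSemistableTwist W 3` ((M) ∨ (G-ord, `e = 2`)), every rational `3`-line `Φ ≤ W[3]` and every Teichmüller pair of
  `Φ`, one member is unramified above `3` (the (M) model from `PotMult.exists_mult_pStar_twist_model`, the (G-ord) partner from
  `exists_goodOrd_partner_of_subGordTwo_odd`).  With x1's [LOCp] (good ordinary, ramified line) and [LOCp-mult] this completes the local
  table of Teichmüller pairs at `3` for the rank-one residual cells: {good ordinary, multiplicative} × {untwisted, `(−3)`-twisted}.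

HONEST FRAMING: theorems only — finite group theory / Galois bookkeeping over tree theorems (TB-TOL, Tate uniformisation PROVED in the tree,
Teichmüller rigidity); no definition, no named fact, no `sorry`; no analytic statement; nothing is closed; BSD proved for no curve; «closes rung:
none».  References: Serre 1972 §1.11–1.12 [Serre1972]; Silverman ATAEC V.5.3–5.4 [SilvermanATAEC1994]; Silverman AEC X.5 Cor. 5.4 [SilvermanAEC2009];
Lang, Fundamentals of Diophantine Geometry Ch. 6 Prop. 1.3 [Lang1983]; Keller–Yin arXiv:2402.12781 §1.4 [KellerYin2024].
-/

set_option autoImplicit false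
-- `Summit.<P>.<Sub>` repeats `BirchSwinnertonDyer` by the tree's layout convention (D-0017)
set_option linter.dupNamespace false

noncomputable section

open scoped Classical NumberField Pointwise

open Field NumberField IsDedekindDomain WeierstrassCurve
  Literature.NumberTheory.EllipticCurves Literature.NumberTheory.EllipticCurves.GreenbergSelmer
  Literature.NumberTheory.GaloisRepresentations
  Literature.NumberTheory.EllipticCurves.Rank1Residual
  Literature.NumberTheory.EllipticCurves.KellerYin2024
  Summit.BirchSwinnertonDyer.Rank1Residual
  Summit.BirchSwinnertonDyer.Rank1Residual.Additive Summit.BirchSwinnertonDyer.Rank1Residual.AdditivePotMult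
  Summit.BirchSwinnertonDyer.BirchSwinnertonDyer.Theorems.SchneiderFree
  Summit.BirchSwinnertonDyer.BirchSwinnertonDyer.Theorems.EisensteinPrimesMuLambda
  Summit.BirchSwinnertonDyer.BirchSwinnertonDyer.Theorems.TeichmullerPairUnramifiedAtMult
  Summit.BirchSwinnertonDyer.BirchSwinnertonDyer.Theorems.SchneiderFreeAdditiveX3.KYBranchThreeAux

namespace Summit.BirchSwinnertonDyer.BirchSwinnertonDyer.Theorems.SchneiderFreeAdditiveX3.SemistableTwistLocalThreeTeichmuller

/-! ### §1 One inertia group above the place suffices -/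

/-- **Killing ONE inertia group above `v` makes a framed representation unramified at `v`**: the primes above `v` are conjugate
(`exists_smul_eq_of_mem_primesAbove_holds`) and `I_{τ • 𝔓} = τ I_𝔓 τ⁻¹` (`Ideal.conj_mem_inertia_smul_iff`); `ρ(τ σ' τ⁻¹) = ρ(τ)ρ(σ')ρ(τ)⁻¹ = 1`.
[cite: NeukirchANT1999, Ch. I §9 (9.4)–(9.6)] [cite: SerreAbelianLadic1968, Ch. I §2.1] -/
theorem isUnramifiedAt_of_forall_mem_inertia_of_mem_primesAbove {K : Type} [Field K] [NumberField K] {A : Type*} [CommRing A]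
    [TopologicalSpace A] {n : ℕ} (ρ : FramedGaloisRep K A n) (v : HeightOneSpectrum (𝓞 K)) {𝔓 : Ideal (absIntegers (𝓞 K) K)}
    (h𝔓 : 𝔓 ∈ v.primesAbove) (h : ∀ g ∈ 𝔓.inertia (absoluteGaloisGroup K), ρ g = 1) : ρ.IsUnramifiedAt v := by
  intro 𝔓' h𝔓' σ hσ
  obtain ⟨τ, rfl⟩ := HeightOneSpectrum.exists_smul_eq_of_mem_primesAbove_holds h𝔓 h𝔓'
  have hσ_eq : σ = τ * (τ⁻¹ * σ * τ) * τ⁻¹ := by group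
  have hσ' : τ⁻¹ * σ * τ ∈ 𝔓.inertia (absoluteGaloisGroup K) := by
    rwa [← Ideal.conj_mem_inertia_smul_iff 𝔓 τ, ← hσ_eq]
  rw [hσ_eq, map_mul, map_mul, h _ hσ', mul_one, ← map_mul, mul_inv_cancel, map_one]

/-! ### §2 The (M) cell at `3`: one member of the Teichmüller pair of `W = C • V^{(−3)}`, `V` multiplicative, is unramified at `3` -/

section Mult

variable {V W : WeierstrassCurve ℚ} [V.IsElliptic] [V.IsGloballyMinimal] [W.IsElliptic]

/-- **(M) twin of `KYBranchThreeAux.teichmullerPair_isUnramifiedAt_or_of_goodOrd_negThree_twist`.**  For `V` globally minimal with MULTIPLICATIVE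
reduction at `3` (split or not), `W = C • V^{(−3)}`, a rational `3`-line `Φ ≤ W[3]` and Teichmüller lifts `θsub`, `θquot : G_ℚ → GL₁(ℤ₃)` of the
characters on `Φ` and `W[3]/Φ`: `θsub` OR `θquot` is UNRAMIFIED at (every place above) `3`.  TB-TOL on the (M) rows
(`MixedCongruence.exists_twistedOrdinaryLineAt_three_of_mult_twist_model`, fed the tree's PROVED Tate uniformisation
`Silverman1994_thmV53_tateUniformisation_holds` / `Silverman1994_thmV53_corV54_tateUniformisation_holds`) gives an `I_𝔓`-fixed line at some
`𝔓 ∣ 3`; `fix_or_quot_of_fixedLine` + Teichmüller rigidity + §1.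
[cite: SilvermanATAEC1994, Ch. V Thm. 5.3 and Cor. 5.4] [cite: Serre1972, §1.11–1.12] [cite: SilvermanAEC2009, X.5 Cor. 5.4]
[cite: KellerYin2024, §1.4 (arXiv:2402.12781v2 TeX L1063–1086) (Teichmüller pair)] -/
theorem teichmullerPair_isUnramifiedAt_or_of_mult_negThree_twist (hmult : V.HasMultiplicativeReductionAtPrime 3)
    (C : VariableChange ℚ) (hC : C • V.quadraticTwist (-3 : ℚ) = W)
    {Φ : AddSubgroup (geomTorsion W ((3 : ℕ) : ℤ))} (hΦ : IsRationalLine W 3 Φ)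
    {θsub θquot : FramedGaloisRep ℚ (padicCoeffIntegers (∅ : Set (PadicAlgCl 3))) 1}
    (hsub : IsTeichmullerLiftOn (∅ : Set (PadicAlgCl 3)) (Φ.map (geomTorsion W ((3 : ℕ) : ℤ)).subtype) θsub)
    (hquot : IsTeichmullerLiftOnQuot (∅ : Set (PadicAlgCl 3)) (Φ.map (geomTorsion W ((3 : ℕ) : ℤ)).subtype)
      (geomTorsion W ((3 : ℕ) : ℤ)) θquot) :
    (∀ u : HeightOneSpectrum (𝓞 ℚ), ((3 : ℕ) : 𝓞 ℚ) ∈ u.asIdeal → θsub.IsUnramifiedAt u) ∨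
      (∀ u : HeightOneSpectrum (𝓞 ℚ), ((3 : ℕ) : 𝓞 ℚ) ∈ u.asIdeal → θquot.IsUnramifiedAt u) := by
  have hp : Nat.Prime 3 := Fact.out
  have hcardΦ : Nat.card (Φ.map (geomTorsion W ((3 : ℕ) : ℤ)).subtype) = 3 := by
    rw [Nat.card_congr (Φ.equivMapOfInjective (geomTorsion W ((3 : ℕ) : ℤ)).subtype
      (geomTorsion W ((3 : ℕ) : ℤ)).subtype_injective).toEquiv.symm, hΦ.1]
  have hle : Φ.map (geomTorsion W ((3 : ℕ) : ℤ)).subtype ≤ geomTorsion W ((3 : ℕ) : ℤ) := by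
    rintro _ ⟨R, _, rfl⟩
    exact R.2
  -- `ℚ` has one place above `3`
  have huniq : ∀ u u' : HeightOneSpectrum (𝓞 ℚ), ((3 : ℕ) : 𝓞 ℚ) ∈ u.asIdeal → ((3 : ℕ) : 𝓞 ℚ) ∈ u'.asIdeal → u = u' :=
    fun u u' hu hu' ↦ Rat.HeightOneSpectrum.primesEquiv.injective (Subtype.ext
      ((Rat.HeightOneSpectrum.primesEquiv_eq_of_natCast_mem u hp hu).trans
        (Rat.HeightOneSpectrum.primesEquiv_eq_of_natCast_mem u' hp hu').symm))
  -- TB-TOL on the (M) rows: an `I_𝔓`-fixed line of `W[3]` at some prime `𝔓 ∣ 3`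
  obtain ⟨u₀, hu₀, 𝔓, h𝔓, L, hL, hLfix, -⟩ := MixedCongruence.exists_twistedOrdinaryLineAt_three_of_mult_twist_model
    TateCurve.Silverman1994_thmV53_tateUniformisation_holds TateCurve.Silverman1994_thmV53_corV54_tateUniformisation_holds hmult C hC
  rcases fix_or_quot_of_fixedLine (I := 𝔓.inertia (absoluteGaloisGroup ℚ)) hΦ.1 (fun g _ P hP ↦ hΦ.2 g P hP) hL hLfix with hfix | hq
  · refine Or.inl fun u hu ↦ ?_
    rw [huniq u u₀ hu hu₀]
    refine isUnramifiedAt_of_forall_mem_inertia_of_mem_primesAbove θsub u₀ h𝔓 fun g hg ↦ ?_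
    refine apply_eq_one_of_forall_smul_eq W (∅ : Set (PadicAlgCl 3)) hcardΦ hle hsub fun Q hQ ↦ ?_
    obtain ⟨R, hR, rfl⟩ := hQ
    rw [AddSubgroup.coe_subtype, ← AddSubgroup.torsionBy.coe_smul, hfix g hg R hR]
  · refine Or.inr fun u hu ↦ ?_
    rw [huniq u u₀ hu hu₀]
    refine isUnramifiedAt_of_forall_mem_inertia_of_mem_primesAbove θquot u₀ h𝔓 fun g hg ↦ ?_
    refine apply_eq_one_of_forall_smul_sub_mem W (∅ : Set (PadicAlgCl 3)) hcardΦ hquot fun Q hQ ↦ ?_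
    refine ⟨g • ⟨Q, hQ⟩ - ⟨Q, hQ⟩, hq g hg ⟨Q, hQ⟩, ?_⟩
    rw [AddSubgroup.coe_subtype, AddSubgroupClass.coe_sub, AddSubgroup.torsionBy.coe_smul]

end Mult

/-! ### §3 The cell-level statement on B6 ∩ X3 ∩ sst-twist at `p = 3` -/

/-- **On BOTH semistable-twist cells at `p = 3`, one member of every Teichmüller pair is unramified above `3`.**  For every globally minimal `W/ℚ`
with `ClassX3 W 3` and `SubSemistableTwist W 3` (the (M) cell `SubM` = potentially multiplicative, or the (G-ord, `e = 2`) cell `SubGordTwo`), every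
rational `3`-line `Φ ≤ W[3]` and all Teichmüller lifts `θsub`, `θquot` of the characters on `Φ` and `W[3]/Φ`: `θsub` or `θquot` is unramified at
every place above `3`.  (M): the multiplicative `(−3)`-twist model `PotMult.exists_mult_pStar_twist_model` + §2; (G-ord): the good-ordinary partner
`exists_goodOrd_partner_of_subGordTwo_odd` + `KYBranchThreeAux.teichmullerPair_isUnramifiedAt_or_of_goodOrd_negThree_twist`.  This is the hypothesis
"`θ` unramified at `p`" of CGLS 2022 Thm. 2.1.2 / "`p ∤ cond φ`" of §2.2 for one residual character, on the whole board row at `p = 3`.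
[cite: CastellaGrossiLeeSkinner2022, Thm. 2.1.2 and §2.2 (labelling p ∤ cond φ; arXiv:2008.02571v2)] [cite: Serre1972, §1.11–1.12]
[cite: SilvermanATAEC1994, Ch. V Thm. 5.3 and Cor. 5.4] [cite: SilvermanAEC2009, X.5 Cor. 5.4] -/
theorem teichmullerPair_isUnramifiedAt_or_of_classX3_of_subSemistableTwist_three (W : WeierstrassCurve ℚ) [W.IsElliptic]
    [W.IsGloballyMinimal] (hX : ClassX3 W 3) (hS : SubSemistableTwist W 3)
    {Φ : AddSubgroup (geomTorsion W ((3 : ℕ) : ℤ))} (hΦ : IsRationalLine W 3 Φ)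
    {θsub θquot : FramedGaloisRep ℚ (padicCoeffIntegers (∅ : Set (PadicAlgCl 3))) 1}
    (hsub : IsTeichmullerLiftOn (∅ : Set (PadicAlgCl 3)) (Φ.map (geomTorsion W ((3 : ℕ) : ℤ)).subtype) θsub)
    (hquot : IsTeichmullerLiftOnQuot (∅ : Set (PadicAlgCl 3)) (Φ.map (geomTorsion W ((3 : ℕ) : ℤ)).subtype)
      (geomTorsion W ((3 : ℕ) : ℤ)) θquot) :
    (∀ u : HeightOneSpectrum (𝓞 ℚ), ((3 : ℕ) : 𝓞 ℚ) ∈ u.asIdeal → θsub.IsUnramifiedAt u) ∨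
      (∀ u : HeightOneSpectrum (𝓞 ℚ), ((3 : ℕ) : 𝓞 ℚ) ∈ u.asIdeal → θquot.IsUnramifiedAt u) := by
  have hp2 : (3 : ℕ) ≠ 2 := by norm_num
  have h3 : ((-1 : ℚ) ^ ((3 : ℕ) / 2) * ((3 : ℕ) : ℚ)) = (-3 : ℚ) := by norm_num
  rcases hS with hM | hG
  · -- (M): a multiplicative `(−3)`-twist model
    obtain ⟨V, _, _, C, hmV, hC⟩ := PotMult.exists_mult_pStar_twist_model (W := W) (p := 3) ⟨hX.2, hM⟩ hp2
    rw [h3] at hC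
    exact teichmullerPair_isUnramifiedAt_or_of_mult_negThree_twist hmV C hC hΦ hsub hquot
  · -- (G-ord, `e = 2`): the good-ordinary partner
    obtain ⟨V, _, _, C, hC, hordV, -⟩ := exists_goodOrd_partner_of_subGordTwo_odd hp2 W hX hG
    rw [h3] at hC
    exact teichmullerPair_isUnramifiedAt_or_of_goodOrd_negThree_twist hordV.1 (by exact_mod_cast hordV.2) C hC hΦ hsub hquot

end Summit.BirchSwinnertonDyer.BirchSwinnertonDyer.Theorems.SchneiderFreeAdditiveX3.SemistableTwistLocalThreeTeichmuller

end
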